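import Summits.NavierStokesRegularity.NavierStokesRegularity.Theorems.StrainDoorsDSSRecords
import HarnessLib

/-!
# StrainDoorsDSSRecordLaws — THE RECORD LAWS OF A DISCRETELY SELF-SIMILAR SINGULARITY (ROUND-53 PART 3)

nsreg-p1 g35, ROUND-53 PART 3 (helper lane of `stmt-NavierStokesRegularity-0056`, rung N0; lands after PART 2
`StrainDoorsDSSRecords` = DSS period calculus + attainment of the strain number and of the vorticity number).

For a classical unforced solution `(u,p)` on `(−∞,0)` (`ν ≥ 0`) which is `c`-DSS (`c > 1`) with velocity gradient decaying at
spatial infinity uniformly over one period (`|∇u(t,x)| → 0` as `|x| → ∞`, `t ∈ [−c², −1]`; Chae 2015 hypothesis (1.13) in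
self-similar variables; implied by a Type-I gradient bound, `periodGradDecay_of_typeI_grad`), the one-point laws hold
UNCONDITIONALLY at the ATTAINED records (blow-up time `T = 0`):

* ★★ `dss_strain_record_law` — at the strain-number record `(t*,x*,e*)`: `−Δq ≥ 0`, `N* + N*² − ν t*² Δq ≤ t*²·H`,
  `1 ≤ ((H − q²)/q²)·N*` (referee R52 F4 made unconditional on the DSS class);
* ★★ `dss_vorticity_record_law` — at the vorticity-number record `(t_ω,x_ω)`: `1 ≤ (0 − t_ω)(α − ν|∇ξ|²_F)` and
  `1 + ν(0 − t_ω)|∇ξ|²_F ≤ (0 − t_ω)·q(t_ω,x_ω,ξ)`;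
* ★★ `dss_strainNumber_floor` / `dss_strainNumber_attained_ge_one_add_twist` — **the strain number of a DSS singularity
  is at least one plus the scaled twist at its vorticity record**: every majorant `M` of `(0 − s)q(s,y,e')` over `s < 0` obeys
  `1 + ν(0 − t_ω)|∇ξ(t_ω,x_ω)|²_F ≤ M`; the attained maximum `N*` in particular.

WHAT THIS IS NOT: no DSS profile is excluded (`TypeIDSSLiouville` stays open); `0056`/NS regularity are not proved; exact
necessary conditions at two computable points of any DSS blow-up profile.  No new definitions; no sorry.
hard core evaded: NONE CLAIMED.
[cite: ChaeWolf2017RemovingDSS, Theorem 1.1 (arXiv:1610.09464 p. 3); BradshawTsai2017CPDE, §5 Open Problem 5.1;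
GalantiGibbonHeritage1997, §3 (arXiv:chao-dyn/9709003 p. 7)]
-/

noncomputable section

open MeasureTheory Set Function Filter Metric Real InnerProductSpace
open _root_.Topology
open scoped ENNReal NNReal RealInnerProductSpace ContDiff Laplacian
open Literature.Analysis Literature.Analysis.FluidPDE
open Literature.Analysis.FluidPDE.VorticityDirectionDynamics

set_option linter.dupNamespace false

namespace Summit.NavierStokesRegularity.NavierStokesRegularity.Theorems.StrainDoors

open Summit.NavierStokesRegularity.NavierStokesRegularity.Theorems.ArgmaxDoors

set_option maxSynthPendingDepth 3

/-! ## §3 The record laws of a DSS singularity (unconditional modulo gradient decay) -/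

/-- ★★ **THE STRAIN RECORD LAW OF A DSS SINGULARITY** (referee R52 F4, unconditional on the DSS class).  Classical
unforced solution `(u,p)` on `(−∞,0)` (`ν ≥ 0`), `c`-DSS (`c > 1`), gradient decaying at spatial infinity over the
period, positive strain somewhere.  Then at the ATTAINED strain-number record `(t*,x*,e*)` (`t* < 0`, `|e*| = 1`,
`q* = q(t*,x*,e*) > 0`, `N* = (0 − t*)q*` the space-time maximum):
(i) `−Δq(t*,x*,e*) ≥ 0`;  (ii) `N* + N*² − ν t*² Δq ≤ t*²·H(t*,x*,e*)` (`H = strainFeed`, the pressure-Hessian/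
vortex feed of `StrainDoorsDefs`);  (iii) `1 ≤ ((H − q*²)/q*²)·N*`. [folklore] -/
theorem dss_strain_record_law {ν c : ℝ} (hν : 0 ≤ ν) (hc : 1 < c)
    {u : ℝ → (EuclideanSpace ℝ (Fin 3)) → (EuclideanSpace ℝ (Fin 3))} {p : ℝ → (EuclideanSpace ℝ (Fin 3)) → ℝ}
    (hsol : IsClassicalNSSolutionOn (Iio 0) ν 0 u p) (hdss : IsDiscretelySelfSimilar c u)
    (hdecay : ∀ ε : ℝ, 0 < ε → ∃ R : ℝ, ∀ t ∈ Icc (-(c ^ 2)) (-1), ∀ x : EuclideanSpace ℝ (Fin 3),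
      R ≤ ‖x‖ → ‖fderiv ℝ (u t) x‖ ≤ ε)
    (hpos : ∃ t₀ : ℝ, t₀ < 0 ∧ ∃ x₀ e₀ : EuclideanSpace ℝ (Fin 3), ‖e₀‖ = 1 ∧ 0 < strainQuad u t₀ x₀ e₀) :
    ∃ t : ℝ, t < 0 ∧ ∃ x e : EuclideanSpace ℝ (Fin 3), ‖e‖ = 1 ∧ 0 < strainQuad u t x e ∧
      (∀ s : ℝ, s < 0 → ∀ y e' : EuclideanSpace ℝ (Fin 3), ‖e'‖ = 1 →
        (0 - s) * strainQuad u s y e' ≤ (0 - t) * strainQuad u t x e) ∧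
      strainLap u t x e ≤ 0 ∧
      (0 - t) * strainQuad u t x e + ((0 - t) * strainQuad u t x e) ^ 2
          - ν * (0 - t) ^ 2 * strainLap u t x e ≤ (0 - t) ^ 2 * strainFeed u p t x e ∧
      1 ≤ (strainFeed u p t x e - (strainQuad u t x e) ^ 2) / (strainQuad u t x e) ^ 2 *
            ((0 - t) * strainQuad u t x e) := by
  obtain ⟨t, ht, x, e, he, hq, hsup⟩ := dss_strainNumber_attained hc hsol.smooth_velocity hdss hdecay hpos
  have hS : UniqueDiffOn ℝ (Iio (0 : ℝ)) := uniqueDiffOn_Iio 0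
  have hcl : Iio (0 : ℝ) ⊆ closure (interior (Iio 0)) := by rw [interior_Iio]; exact subset_closure
  have ht' : t ∈ Iio (0 : ℝ) := ht
  have htn : Iio (0 : ℝ) ∈ 𝓝 t := Iio_mem_nhds ht
  have hTt : 0 < 0 - t := by linarith
  have hmaxX : ∀ y, strainQuad u t y e ≤ strainQuad u t x e := fun y =>
    le_of_mul_le_mul_left (hsup t ht y e he) hTt
  have hmaxT : IsLocalMax (fun s => (0 - s) * strainQuad u s x e) t := by
    filter_upwards [htn] with s hs
    exact hsup s hs x e he
  -- (i) the Laplacian sign at the spatial maximum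
  have hu : ContDiff ℝ ∞ (u t) := hsol.smooth_velocity.contDiff_slice ht'
  have hmaxX' : ∀ y, ⟪fderiv ℝ (u t) y e, e⟫ ≤ ⟪fderiv ℝ (u t) x e, e⟫ := hmaxX
  have h1 := inner_fderiv_laplacian_le_zero_of_isMax hu x e hmaxX'
  rw [inner_fderiv_laplacian_eq_laplacian_strain hu x e] at h1
  have hlap : strainLap u t x e ≤ 0 := h1
  -- (ii) the full inequality with the viscous credit
  have hloc : IsLocalMax (fun y => strainQuad u t y e) x := Filter.Eventually.of_forall fun y => hmaxX y
  have hcrit : fderiv ℝ (fun y => strainQuad u t y e) x = 0 := hloc.fderiv_eq_zero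
  have htime := strainNumber_fermat hsol.smooth_velocity hS htn x e 0 hmaxT
  have hineq := spacetime_record_inequality hS hcl hsol ht' he hcrit htime
  -- (iii) the defect form
  have hdef := spacetime_defect_law hν hS hcl hsol htn ht he hmaxX hmaxT hq
  exact ⟨t, ht, x, e, he, hq, hsup, hlap, hineq, hdef⟩

/-- ★★ **THE VORTICITY RECORD LAW OF A DSS SINGULARITY.**  Classical unforced solution on `(−∞,0)` (`ν ≥ 0`), `c`-DSS
(`c > 1`), gradient decaying at spatial infinity over the period, `ω ≢ 0`.  Then at the ATTAINED vorticity-number record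
`(t_ω, x_ω)` (`t_ω < 0`, `ω(t_ω,x_ω) ≠ 0`, `(0 − t_ω)|ω(t_ω,x_ω)|` the space-time maximum), with `ξ = ω/|ω|` there:
`1 ≤ (0 − t_ω)·(⟪ξ, ∇u ξ⟫ − ν|∇ξ|²_F)`,  `|ξ| = 1`  and  `1 + ν(0 − t_ω)|∇ξ|²_F ≤ (0 − t_ω)·q(t_ω,x_ω,ξ)`. [folklore] -/
theorem dss_vorticity_record_law {ν c : ℝ} (hν : 0 ≤ ν) (hc : 1 < c)
    {u : ℝ → (EuclideanSpace ℝ (Fin 3)) → (EuclideanSpace ℝ (Fin 3))} {p : ℝ → (EuclideanSpace ℝ (Fin 3)) → ℝ}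
    (hsol : IsClassicalNSSolutionOn (Iio 0) ν 0 u p) (hdss : IsDiscretelySelfSimilar c u)
    (hdecay : ∀ ε : ℝ, 0 < ε → ∃ R : ℝ, ∀ t ∈ Icc (-(c ^ 2)) (-1), ∀ x : EuclideanSpace ℝ (Fin 3),
      R ≤ ‖x‖ → ‖fderiv ℝ (u t) x‖ ≤ ε)
    (hcurl : ∃ t₀ : ℝ, t₀ < 0 ∧ ∃ x₀ : EuclideanSpace ℝ (Fin 3), curl (u t₀) x₀ ≠ 0) :
    ∃ t : ℝ, t < 0 ∧ ∃ x : EuclideanSpace ℝ (Fin 3), curl (u t) x ≠ 0 ∧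
      (∀ s : ℝ, s < 0 → ∀ y : EuclideanSpace ℝ (Fin 3), (0 - s) * ‖curl (u s) y‖ ≤ (0 - t) * ‖curl (u t) x‖) ∧
      1 ≤ (0 - t) *
        (⟪vorticityDirection (curl (u t)) x, fderiv ℝ (u t) x (vorticityDirection (curl (u t)) x)⟫ -
          ν * frobeniusNormSq (fderiv ℝ (vorticityDirection (curl (u t))) x)) ∧
      ‖vorticityDirection (curl (u t)) x‖ = 1 ∧
      1 + ν * (0 - t) * frobeniusNormSq (fderiv ℝ (vorticityDirection (curl (u t))) x) ≤
        (0 - t) * strainQuad u t x (vorticityDirection (curl (u t)) x) := by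
  obtain ⟨t, ht, x, hne, hsup⟩ := dss_vorticityNumber_attained hc hsol.smooth_velocity hdss hdecay hcurl
  have hS : UniqueDiffOn ℝ (Iio (0 : ℝ)) := uniqueDiffOn_Iio 0
  have htn : Iio (0 : ℝ) ∈ 𝓝 t := Iio_mem_nhds ht
  have hTt : 0 < 0 - t := by linarith
  have hmaxX : ∀ y, ‖curl (u t) y‖ ≤ ‖curl (u t) x‖ := fun y => le_of_mul_le_mul_left (hsup t ht y) hTt
  have hmaxT : IsLocalMaxOn (fun s => (0 - s) * ‖curl (u s) x‖) (Iic t) t := by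
    show ∀ᶠ s in 𝓝[Iic t] t, (0 - s) * ‖curl (u s) x‖ ≤ (0 - t) * ‖curl (u t) x‖
    filter_upwards [mem_nhdsWithin_of_mem_nhds htn] with s hs
    exact hsup s hs x
  have h1 := vorticity_record_law hν hS hsol htn ht hmaxX hmaxT hne
  have h2 := strainNumber_floor_at_vorticity_record hν hS hsol htn ht hmaxX hmaxT hne
  exact ⟨t, ht, x, hne, hsup, h1, h2.1, h2.2⟩

/-- ★★ **THE STRAIN NUMBER OF A DSS SINGULARITY IS AT LEAST ONE PLUS THE SCALED TWIST AT ITS VORTICITY RECORD.**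
Same class (`ω ≢ 0`).  Every majorant `M` of the strain number — `(0 − s)·q(s,y,e') ≤ M` for all `s < 0`, `y`, unit
`e'` (by `dss_strainNumber_attained` the least one is the attained `N*`) — satisfies, at the attained vorticity record
`(t_ω,x_ω)`:  `1 + ν(0 − t_ω)|∇ξ(t_ω,x_ω)|²_F ≤ M`, in particular `1 ≤ M`.  The BKM-threshold `N* ≥ 1` of the
strain-number door is thus SHARPENED on the DSS class by the fine structure of the vorticity direction: equality
`N* = 1` forces `∇ξ = 0` at the vorticity record. [folklore] -/
theorem dss_strainNumber_floor {ν c : ℝ} (hν : 0 ≤ ν) (hc : 1 < c)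
    {u : ℝ → (EuclideanSpace ℝ (Fin 3)) → (EuclideanSpace ℝ (Fin 3))} {p : ℝ → (EuclideanSpace ℝ (Fin 3)) → ℝ}
    (hsol : IsClassicalNSSolutionOn (Iio 0) ν 0 u p) (hdss : IsDiscretelySelfSimilar c u)
    (hdecay : ∀ ε : ℝ, 0 < ε → ∃ R : ℝ, ∀ t ∈ Icc (-(c ^ 2)) (-1), ∀ x : EuclideanSpace ℝ (Fin 3),
      R ≤ ‖x‖ → ‖fderiv ℝ (u t) x‖ ≤ ε)
    (hcurl : ∃ t₀ : ℝ, t₀ < 0 ∧ ∃ x₀ : EuclideanSpace ℝ (Fin 3), curl (u t₀) x₀ ≠ 0) {M : ℝ}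
    (hM : ∀ s : ℝ, s < 0 → ∀ y e' : EuclideanSpace ℝ (Fin 3), ‖e'‖ = 1 → (0 - s) * strainQuad u s y e' ≤ M) :
    1 ≤ M ∧ ∃ t : ℝ, t < 0 ∧ ∃ x : EuclideanSpace ℝ (Fin 3), curl (u t) x ≠ 0 ∧
      (∀ s : ℝ, s < 0 → ∀ y : EuclideanSpace ℝ (Fin 3), (0 - s) * ‖curl (u s) y‖ ≤ (0 - t) * ‖curl (u t) x‖) ∧
      1 + ν * (0 - t) * frobeniusNormSq (fderiv ℝ (vorticityDirection (curl (u t))) x) ≤ M := by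
  obtain ⟨t, ht, x, hne, hsup, -, hξ, hfloor⟩ := dss_vorticity_record_law hν hc hsol hdss hdecay hcurl
  have h1 := hfloor.trans (hM t ht x _ hξ)
  have hF : 0 ≤ frobeniusNormSq (fderiv ℝ (vorticityDirection (curl (u t))) x) := frobeniusNormSq_nonneg _
  have hprod : 0 ≤ ν * (0 - t) * frobeniusNormSq (fderiv ℝ (vorticityDirection (curl (u t))) x) :=
    mul_nonneg (mul_nonneg hν (by linarith)) hF
  exact ⟨by linarith, t, ht, x, hne, hsup, h1⟩

/-- ★★ **Corollary: the attained strain number of a DSS singularity with non-zero vorticity is `≥ 1 + scaled twist`.**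
Combining `dss_strainNumber_attained` and `dss_strainNumber_floor`: some `(t*,x*,e*)` realises the space-time maximum
`N*` of the strain number, and `N* ≥ 1 + ν(0 − t_ω)|∇ξ(t_ω,x_ω)|²_F ≥ 1` where `(t_ω,x_ω)` is the vorticity record.
(Positive strain somewhere follows from `ω ≢ 0` for decaying fields but is kept as a hypothesis.) [folklore] -/
theorem dss_strainNumber_attained_ge_one_add_twist {ν c : ℝ} (hν : 0 ≤ ν) (hc : 1 < c)
    {u : ℝ → (EuclideanSpace ℝ (Fin 3)) → (EuclideanSpace ℝ (Fin 3))} {p : ℝ → (EuclideanSpace ℝ (Fin 3)) → ℝ}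
    (hsol : IsClassicalNSSolutionOn (Iio 0) ν 0 u p) (hdss : IsDiscretelySelfSimilar c u)
    (hdecay : ∀ ε : ℝ, 0 < ε → ∃ R : ℝ, ∀ t ∈ Icc (-(c ^ 2)) (-1), ∀ x : EuclideanSpace ℝ (Fin 3),
      R ≤ ‖x‖ → ‖fderiv ℝ (u t) x‖ ≤ ε)
    (hpos : ∃ t₀ : ℝ, t₀ < 0 ∧ ∃ x₀ e₀ : EuclideanSpace ℝ (Fin 3), ‖e₀‖ = 1 ∧ 0 < strainQuad u t₀ x₀ e₀)
    (hcurl : ∃ t₀ : ℝ, t₀ < 0 ∧ ∃ x₀ : EuclideanSpace ℝ (Fin 3), curl (u t₀) x₀ ≠ 0) :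
    ∃ t : ℝ, t < 0 ∧ ∃ x e : EuclideanSpace ℝ (Fin 3), ‖e‖ = 1 ∧
      (∀ s : ℝ, s < 0 → ∀ y e' : EuclideanSpace ℝ (Fin 3), ‖e'‖ = 1 →
        (0 - s) * strainQuad u s y e' ≤ (0 - t) * strainQuad u t x e) ∧
      ∃ tω : ℝ, tω < 0 ∧ ∃ xω : EuclideanSpace ℝ (Fin 3), curl (u tω) xω ≠ 0 ∧
        (∀ s : ℝ, s < 0 → ∀ y : EuclideanSpace ℝ (Fin 3),
          (0 - s) * ‖curl (u s) y‖ ≤ (0 - tω) * ‖curl (u tω) xω‖) ∧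
        1 + ν * (0 - tω) * frobeniusNormSq (fderiv ℝ (vorticityDirection (curl (u tω))) xω) ≤
          (0 - t) * strainQuad u t x e ∧
        1 ≤ (0 - t) * strainQuad u t x e := by
  obtain ⟨t, ht, x, e, he, -, hsup⟩ := dss_strainNumber_attained hc hsol.smooth_velocity hdss hdecay hpos
  obtain ⟨hone, tω, htω, xω, hneω, hsupω, hfl⟩ := dss_strainNumber_floor hν hc hsol hdss hdecay hcurl hsup
  exact ⟨t, ht, x, e, he, hsup, tω, htω, xω, hneω, hsupω, hfl, hone⟩

end Summit.NavierStokesRegularity.NavierStokesRegularity.Theorems.StrainDoors
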